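/-
COR-CM (cell pub-hodgecm2, stage 2 of the Hodge ladder) — count-neutral KERNEL CENSUS → TREE TRANSPORT of the faithful full EVEN
slice, NUMERIC INSTANCES (seat prover-pub-hodgecm2-b23-g37-0, binder prover b23, gen 37; claim EVEN-SLICE F5 (addendum),
HOME/INBOX.md 2026-08-22; sequel of `Census/EvenSliceFaceTransport.lean` and `Census/EvenSliceOrbitCount.lean`).  Theorems only: the
`Aut`-datum transport `exists_faceSet_evenSliceSquares_aut` with the orbit counts `card_orbitsA_zmod_{four,six,eight,ten,twelve}`,
`card_orbitsA_zmod_two_{sq,cube}` substituted BY NAME; no definition, no named fact, nothing asserted; `Interfaces.lean` (C1), every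
E term, B01 and `Transposition/*` are untouched.
HONEST FRAMING (COORDINATOR RULING — HODGE FRAMING CORRECTION, 2026-08-21T11:55:35Z): `HC_CM` is NOT proved, here or anywhere in
the tree.  Every theorem below says, for ONE Galois CM field `K` of the stated Galois type: a set of at most `N` rank-four faces of `K`
EXISTS whose face periods on the universe of record would imply the Hodge conjecture for the abelian varieties generated by `K`; no
period is produced and nothing is discharged for any field.
T5 (coordinator ruling 15:33:56Z (3)): binder sets = those of `Census/EvenSliceFaceTransport.lean` (`Aut`-datum, face periods =
crux instances with no `¬` theorem in the tree) — no contradiction derivable; checker: self (prover-pub-hodgecm2-b23-g37-0), 2026-08-22.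
-/
import Summits.HodgeConjecture.CorCM.Census.EvenSliceFaceTransport
import Summits.HodgeConjecture.CorCM.Census.EvenSliceOrbitCount
import HarnessLib

/-!
# The faithful full even slice, transported — the numbers: `2, 6, 18, 54, 178, 3, 28` faces

Instances BY NAME of `exists_faceSet_evenSliceSquares_aut` (`Census/EvenSliceFaceTransport.lean`: a Galois CM field `K`, a bijection
`ε : Aut(K) ≃ ℤ/2 × A` multiplicative-to-additive carrying the complex conjugation at `σ₀` to `(1,0)`, `|A|` even `≥ 4` ⟹ a set `𝒮`
of rank-four faces with `|𝒮| + 1 ≤ #OrbitsA A` whose periods on the universe of record imply the Hodge conjecture for every complex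
abelian variety dominated by a finite product of abelian varieties realising CM types of CM fields embeddable in `K`) with the orbit
counts of `Census/EvenSliceOrbitCount.lean`:

| `A` | Galois group of `K` | fields | `#OrbitsA A` | faces `≤` |
|---|---|---|---|---|
| `ℤ/4` | `ℤ/2 × ℤ/4`, `c ∉ 2G` | `ℚ(ζ₁₅)`, `ℚ(ζ₁₆)`, `ℚ(ζ₂₀)`, `k·F₀` with `F₀` real cyclic quartic | `3` | `2` |
| `(ℤ/2)²` | `(ℤ/2)³` | `ℚ(ζ₂₄)`, `ℚ(√−d, √a, √b)` | `4` | `3` |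
| `ℤ/6` | `ℤ/2 × ℤ/6` | `ℚ(ζ₂₁)`, `ℚ(ζ₂₈)`, `ℚ(ζ₃₆)` | `7` | `6` |
| `ℤ/8` | `ℤ/2 × ℤ/8`, `c ∉ 2G` | `ℚ(ζ₃₂)` | `19` | `18` |
| `(ℤ/2)³` | `(ℤ/2)⁴` | `ℚ(√−d, √a, √b, √e)` | `29` | `28` |
| `ℤ/10` | `ℤ/2 × ℤ/10` | `ℚ(ζ₃₃)`, `ℚ(ζ₄₄)` | `55` | `54` |
| `ℤ/12` | `ℤ/2 × ℤ/12`, `c ∉ 2G` | `ℚ(ζ₃₅)`, `ℚ(ζ₃₉)`, `ℚ(ζ₄₅)`, `ℚ(ζ₅₂)` | `179` | `178` |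

The first three rows are the landed census minima (`Census/OcticFaceTransportAbelian.lean` `C4C2Nonsquare`: `2`;
`Census/OcticFaceTransportTriquadratic.lean`: `3`; `Census/DuodecicFaceTransportC6C2.lean`: `6`), now certificate-free; by seat b09's
parity floor (`CorCM/FaceParityFloor.lean`) none of these numbers can be lowered.  (FRAMING: existence of the face set + a conditional;
`HC_CM` is not proved, no period is produced.)

References: [cite: Pohlmann1968, Thm. 1]; [cite: Milne1999LefschetzClasses, Thm. 3.2 and Cor. 4.5];
[cite: Shimura1998, §6.2 Theorem 3 and §6.1 Corollary of Theorem 2 (pp. 41–43)]; [cite: MumfordAV1970, §19 Thm. 1 and p. 169].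
-/

noncomputable section

open CategoryTheory NumberField NumberField.ComplexEmbedding
open Literature.AlgebraicGeometry Literature.AlgebraicGeometry.Motives Literature.AlgebraicGeometry.HodgeTheory
open Literature.AlgebraicGeometry.ComplexMultiplication Literature.AlgebraicGeometry.Milne1999
open Literature.NumberTheory.Automorphic
open Literature.NumberTheory.Automorphic.PicardCM
open Summit.HodgeConjecture.CorCM.Domination

namespace Summit.HodgeConjecture.CorCM

open Summit.HodgeConjecture.CorCM.Census.OddDegreeParityLaw (OrbitsA)
open Summit.HodgeConjecture.CorCM.Census.EvenSliceOrbitCount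

/-! ## The numeric instances -/

section Counts

/-- **`ℤ/2 × ℤ/4` with `c ∉ 2G` (`ℚ(ζ₁₅)`, `ℚ(ζ₁₆)`, `ℚ(ζ₂₀)`, an imaginary quadratic field times a real cyclic quartic field): at most `2` faces** whose periods on the universe of record imply the Hodge conjecture for every complex abelian variety dominated by a
finite product of abelian varieties realising CM types of CM fields embeddable in `K` (`card_orbitsA_zmod_four`).  (FRAMING: existence of the face
set + a conditional; `HC_CM` is not proved, no period is produced.)
[cite: Shimura1998, §6.2 Theorem 3 and §6.1 Corollary of Theorem 2 (pp. 41–43)] [cite: Pohlmann1968, Thm. 1]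
[cite: Milne1999LefschetzClasses, Thm. 3.2 and Cor. 4.5] [cite: MumfordAV1970, §19 Thm. 1 and p. 169] -/
theorem exists_faceSet_evenSlice_zmod_four (K : CMField) [hGal : IsGalois ℚ K] (σ₀ : (K : Type) →+* ℂ)
    (ε : ((K : Type) ≃ₐ[ℚ] (K : Type)) ≃ ZMod 2 × (ZMod 4))
    (hε : ∀ x y : ((K : Type) ≃ₐ[ℚ] (K : Type)), ε (x * y) = ε x + ε y)
    {c : ((K : Type) ≃ₐ[ℚ] (K : Type))} (hcσ : σ₀.comp (c : (K : Type) →+* (K : Type)) = conjugate σ₀) (hεc : ε c = (1, 0)) :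
    ∃ 𝒮 : Finset (Face K), 𝒮.card ≤ 2 ∧
      ((∀ f ∈ 𝒮, ∃ ι₁ : K →+* ℂ, f.Admissible ι₁ ∧ ∃ (V : HermSpace3 K ι₁) (σ : K →+* ℂ),
        (Model.picardCMUniverse exists_isReal_hodgeModel_holds hodgePQ_independent_of_hodgeModel_holds
          BallQuotient.ballQuotientUniformised_holds cmAbelianVarietyRealised_holds).PeriodNV ι₁ V K f.psi σ) →
      ∀ {P B : AbelianVariety ℂ}, AbelianVariety.IsProductOf (fun B : AbelianVariety ℂ =>
        ∃ (E : Type) (_ : Field E) (_ : NumberField E) (_ : IsCMField E) (_ : E →+* (K : Type)) (Φ : CMType E)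
          (ι : 𝓞 E →+* End B) (θ : E →+* Module.End ℂ (complexBetti B.X 1)),
          IsCMTypeRealisation Φ B ι θ) P →
      AVDominatedBy B P → HodgeConjectureFor B.dim B.X) := by
  have hA : Even (Fintype.card (ZMod 4)) := by rw [ZMod.card]; decide
  have h4 : 4 ≤ Fintype.card (ZMod 4) := by rw [ZMod.card]
  obtain ⟨𝒮, hcard, h⟩ := exists_faceSet_evenSliceSquares_aut K hA h4 σ₀ ε hε hcσ hεc
  refine ⟨𝒮, ?_, h⟩
  rw [← Nat.card_eq_fintype_card, card_orbitsA_zmod_four] at hcard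
  omega

/-- **`(ℤ/2)³` (`ℚ(ζ₂₄)`, `ℚ(√−d, √a, √b)`): at most `3` faces** whose periods on the universe of record imply the Hodge conjecture for every complex abelian variety dominated by a
finite product of abelian varieties realising CM types of CM fields embeddable in `K` (`card_orbitsA_zmod_two_sq`).  (FRAMING: existence of the face
set + a conditional; `HC_CM` is not proved, no period is produced.)
[cite: Shimura1998, §6.2 Theorem 3 and §6.1 Corollary of Theorem 2 (pp. 41–43)] [cite: Pohlmann1968, Thm. 1]
[cite: Milne1999LefschetzClasses, Thm. 3.2 and Cor. 4.5] [cite: MumfordAV1970, §19 Thm. 1 and p. 169] -/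
theorem exists_faceSet_evenSlice_zmod_two_sq (K : CMField) [hGal : IsGalois ℚ K] (σ₀ : (K : Type) →+* ℂ)
    (ε : ((K : Type) ≃ₐ[ℚ] (K : Type)) ≃ ZMod 2 × (ZMod 2 × ZMod 2))
    (hε : ∀ x y : ((K : Type) ≃ₐ[ℚ] (K : Type)), ε (x * y) = ε x + ε y)
    {c : ((K : Type) ≃ₐ[ℚ] (K : Type))} (hcσ : σ₀.comp (c : (K : Type) →+* (K : Type)) = conjugate σ₀) (hεc : ε c = (1, 0)) :
    ∃ 𝒮 : Finset (Face K), 𝒮.card ≤ 3 ∧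
      ((∀ f ∈ 𝒮, ∃ ι₁ : K →+* ℂ, f.Admissible ι₁ ∧ ∃ (V : HermSpace3 K ι₁) (σ : K →+* ℂ),
        (Model.picardCMUniverse exists_isReal_hodgeModel_holds hodgePQ_independent_of_hodgeModel_holds
          BallQuotient.ballQuotientUniformised_holds cmAbelianVarietyRealised_holds).PeriodNV ι₁ V K f.psi σ) →
      ∀ {P B : AbelianVariety ℂ}, AbelianVariety.IsProductOf (fun B : AbelianVariety ℂ =>
        ∃ (E : Type) (_ : Field E) (_ : NumberField E) (_ : IsCMField E) (_ : E →+* (K : Type)) (Φ : CMType E)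
          (ι : 𝓞 E →+* End B) (θ : E →+* Module.End ℂ (complexBetti B.X 1)),
          IsCMTypeRealisation Φ B ι θ) P →
      AVDominatedBy B P → HodgeConjectureFor B.dim B.X) := by
  have hA : Even (Fintype.card (ZMod 2 × ZMod 2)) := by rw [Fintype.card_prod, ZMod.card]; decide
  have h4 : 4 ≤ Fintype.card (ZMod 2 × ZMod 2) := by rw [Fintype.card_prod, ZMod.card]
  obtain ⟨𝒮, hcard, h⟩ := exists_faceSet_evenSliceSquares_aut K hA h4 σ₀ ε hε hcσ hεc
  refine ⟨𝒮, ?_, h⟩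
  rw [← Nat.card_eq_fintype_card, card_orbitsA_zmod_two_sq] at hcard
  omega

/-- **`ℤ/2 × ℤ/6` (`ℚ(ζ₂₁)`, `ℚ(ζ₂₈)`, `ℚ(ζ₃₆)`): at most `6` faces** whose periods on the universe of record imply the Hodge conjecture for every complex abelian variety dominated by a
finite product of abelian varieties realising CM types of CM fields embeddable in `K` (`card_orbitsA_zmod_six`).  (FRAMING: existence of the face
set + a conditional; `HC_CM` is not proved, no period is produced.)
[cite: Shimura1998, §6.2 Theorem 3 and §6.1 Corollary of Theorem 2 (pp. 41–43)] [cite: Pohlmann1968, Thm. 1]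
[cite: Milne1999LefschetzClasses, Thm. 3.2 and Cor. 4.5] [cite: MumfordAV1970, §19 Thm. 1 and p. 169] -/
theorem exists_faceSet_evenSlice_zmod_six (K : CMField) [hGal : IsGalois ℚ K] (σ₀ : (K : Type) →+* ℂ)
    (ε : ((K : Type) ≃ₐ[ℚ] (K : Type)) ≃ ZMod 2 × (ZMod 6))
    (hε : ∀ x y : ((K : Type) ≃ₐ[ℚ] (K : Type)), ε (x * y) = ε x + ε y)
    {c : ((K : Type) ≃ₐ[ℚ] (K : Type))} (hcσ : σ₀.comp (c : (K : Type) →+* (K : Type)) = conjugate σ₀) (hεc : ε c = (1, 0)) :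
    ∃ 𝒮 : Finset (Face K), 𝒮.card ≤ 6 ∧
      ((∀ f ∈ 𝒮, ∃ ι₁ : K →+* ℂ, f.Admissible ι₁ ∧ ∃ (V : HermSpace3 K ι₁) (σ : K →+* ℂ),
        (Model.picardCMUniverse exists_isReal_hodgeModel_holds hodgePQ_independent_of_hodgeModel_holds
          BallQuotient.ballQuotientUniformised_holds cmAbelianVarietyRealised_holds).PeriodNV ι₁ V K f.psi σ) →
      ∀ {P B : AbelianVariety ℂ}, AbelianVariety.IsProductOf (fun B : AbelianVariety ℂ =>
        ∃ (E : Type) (_ : Field E) (_ : NumberField E) (_ : IsCMField E) (_ : E →+* (K : Type)) (Φ : CMType E)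
          (ι : 𝓞 E →+* End B) (θ : E →+* Module.End ℂ (complexBetti B.X 1)),
          IsCMTypeRealisation Φ B ι θ) P →
      AVDominatedBy B P → HodgeConjectureFor B.dim B.X) := by
  have hA : Even (Fintype.card (ZMod 6)) := by rw [ZMod.card]; decide
  have h4 : 4 ≤ Fintype.card (ZMod 6) := by rw [ZMod.card]; decide
  obtain ⟨𝒮, hcard, h⟩ := exists_faceSet_evenSliceSquares_aut K hA h4 σ₀ ε hε hcσ hεc
  refine ⟨𝒮, ?_, h⟩
  rw [← Nat.card_eq_fintype_card, card_orbitsA_zmod_six] at hcard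
  omega

/-- **`ℤ/2 × ℤ/8` with `c ∉ 2G` (`ℚ(ζ₃₂)`): at most `18` faces** whose periods on the universe of record imply the Hodge conjecture for every complex abelian variety dominated by a
finite product of abelian varieties realising CM types of CM fields embeddable in `K` (`card_orbitsA_zmod_eight`).  (FRAMING: existence of the face
set + a conditional; `HC_CM` is not proved, no period is produced.)
[cite: Shimura1998, §6.2 Theorem 3 and §6.1 Corollary of Theorem 2 (pp. 41–43)] [cite: Pohlmann1968, Thm. 1]
[cite: Milne1999LefschetzClasses, Thm. 3.2 and Cor. 4.5] [cite: MumfordAV1970, §19 Thm. 1 and p. 169] -/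
theorem exists_faceSet_evenSlice_zmod_eight (K : CMField) [hGal : IsGalois ℚ K] (σ₀ : (K : Type) →+* ℂ)
    (ε : ((K : Type) ≃ₐ[ℚ] (K : Type)) ≃ ZMod 2 × (ZMod 8))
    (hε : ∀ x y : ((K : Type) ≃ₐ[ℚ] (K : Type)), ε (x * y) = ε x + ε y)
    {c : ((K : Type) ≃ₐ[ℚ] (K : Type))} (hcσ : σ₀.comp (c : (K : Type) →+* (K : Type)) = conjugate σ₀) (hεc : ε c = (1, 0)) :
    ∃ 𝒮 : Finset (Face K), 𝒮.card ≤ 18 ∧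
      ((∀ f ∈ 𝒮, ∃ ι₁ : K →+* ℂ, f.Admissible ι₁ ∧ ∃ (V : HermSpace3 K ι₁) (σ : K →+* ℂ),
        (Model.picardCMUniverse exists_isReal_hodgeModel_holds hodgePQ_independent_of_hodgeModel_holds
          BallQuotient.ballQuotientUniformised_holds cmAbelianVarietyRealised_holds).PeriodNV ι₁ V K f.psi σ) →
      ∀ {P B : AbelianVariety ℂ}, AbelianVariety.IsProductOf (fun B : AbelianVariety ℂ =>
        ∃ (E : Type) (_ : Field E) (_ : NumberField E) (_ : IsCMField E) (_ : E →+* (K : Type)) (Φ : CMType E)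
          (ι : 𝓞 E →+* End B) (θ : E →+* Module.End ℂ (complexBetti B.X 1)),
          IsCMTypeRealisation Φ B ι θ) P →
      AVDominatedBy B P → HodgeConjectureFor B.dim B.X) := by
  have hA : Even (Fintype.card (ZMod 8)) := by rw [ZMod.card]; decide
  have h4 : 4 ≤ Fintype.card (ZMod 8) := by rw [ZMod.card]; decide
  obtain ⟨𝒮, hcard, h⟩ := exists_faceSet_evenSliceSquares_aut K hA h4 σ₀ ε hε hcσ hεc
  refine ⟨𝒮, ?_, h⟩
  rw [← Nat.card_eq_fintype_card, card_orbitsA_zmod_eight] at hcard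
  omega

/-- **`(ℤ/2)⁴` (`ℚ(√−d, √a, √b, √e)`): at most `28` faces** whose periods on the universe of record imply the Hodge conjecture for every complex abelian variety dominated by a
finite product of abelian varieties realising CM types of CM fields embeddable in `K` (`card_orbitsA_zmod_two_cube`).  (FRAMING: existence of the face
set + a conditional; `HC_CM` is not proved, no period is produced.)
[cite: Shimura1998, §6.2 Theorem 3 and §6.1 Corollary of Theorem 2 (pp. 41–43)] [cite: Pohlmann1968, Thm. 1]
[cite: Milne1999LefschetzClasses, Thm. 3.2 and Cor. 4.5] [cite: MumfordAV1970, §19 Thm. 1 and p. 169] -/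
theorem exists_faceSet_evenSlice_zmod_two_cube (K : CMField) [hGal : IsGalois ℚ K] (σ₀ : (K : Type) →+* ℂ)
    (ε : ((K : Type) ≃ₐ[ℚ] (K : Type)) ≃ ZMod 2 × (ZMod 2 × ZMod 2 × ZMod 2))
    (hε : ∀ x y : ((K : Type) ≃ₐ[ℚ] (K : Type)), ε (x * y) = ε x + ε y)
    {c : ((K : Type) ≃ₐ[ℚ] (K : Type))} (hcσ : σ₀.comp (c : (K : Type) →+* (K : Type)) = conjugate σ₀) (hεc : ε c = (1, 0)) :
    ∃ 𝒮 : Finset (Face K), 𝒮.card ≤ 28 ∧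
      ((∀ f ∈ 𝒮, ∃ ι₁ : K →+* ℂ, f.Admissible ι₁ ∧ ∃ (V : HermSpace3 K ι₁) (σ : K →+* ℂ),
        (Model.picardCMUniverse exists_isReal_hodgeModel_holds hodgePQ_independent_of_hodgeModel_holds
          BallQuotient.ballQuotientUniformised_holds cmAbelianVarietyRealised_holds).PeriodNV ι₁ V K f.psi σ) →
      ∀ {P B : AbelianVariety ℂ}, AbelianVariety.IsProductOf (fun B : AbelianVariety ℂ =>
        ∃ (E : Type) (_ : Field E) (_ : NumberField E) (_ : IsCMField E) (_ : E →+* (K : Type)) (Φ : CMType E)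
          (ι : 𝓞 E →+* End B) (θ : E →+* Module.End ℂ (complexBetti B.X 1)),
          IsCMTypeRealisation Φ B ι θ) P →
      AVDominatedBy B P → HodgeConjectureFor B.dim B.X) := by
  have hA : Even (Fintype.card (ZMod 2 × ZMod 2 × ZMod 2)) := by rw [Fintype.card_prod, Fintype.card_prod, ZMod.card]; decide
  have h4 : 4 ≤ Fintype.card (ZMod 2 × ZMod 2 × ZMod 2) := by rw [Fintype.card_prod, Fintype.card_prod, ZMod.card]; decide
  obtain ⟨𝒮, hcard, h⟩ := exists_faceSet_evenSliceSquares_aut K hA h4 σ₀ ε hε hcσ hεc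
  refine ⟨𝒮, ?_, h⟩
  rw [← Nat.card_eq_fintype_card, card_orbitsA_zmod_two_cube] at hcard
  omega

/-- **`ℤ/2 × ℤ/10` (`ℚ(ζ₃₃)`, `ℚ(ζ₄₄)`): at most `54` faces** whose periods on the universe of record imply the Hodge conjecture for every complex abelian variety dominated by a
finite product of abelian varieties realising CM types of CM fields embeddable in `K` (`card_orbitsA_zmod_ten`).  (FRAMING: existence of the face
set + a conditional; `HC_CM` is not proved, no period is produced.)
[cite: Shimura1998, §6.2 Theorem 3 and §6.1 Corollary of Theorem 2 (pp. 41–43)] [cite: Pohlmann1968, Thm. 1]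
[cite: Milne1999LefschetzClasses, Thm. 3.2 and Cor. 4.5] [cite: MumfordAV1970, §19 Thm. 1 and p. 169] -/
theorem exists_faceSet_evenSlice_zmod_ten (K : CMField) [hGal : IsGalois ℚ K] (σ₀ : (K : Type) →+* ℂ)
    (ε : ((K : Type) ≃ₐ[ℚ] (K : Type)) ≃ ZMod 2 × (ZMod 10))
    (hε : ∀ x y : ((K : Type) ≃ₐ[ℚ] (K : Type)), ε (x * y) = ε x + ε y)
    {c : ((K : Type) ≃ₐ[ℚ] (K : Type))} (hcσ : σ₀.comp (c : (K : Type) →+* (K : Type)) = conjugate σ₀) (hεc : ε c = (1, 0)) :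
    ∃ 𝒮 : Finset (Face K), 𝒮.card ≤ 54 ∧
      ((∀ f ∈ 𝒮, ∃ ι₁ : K →+* ℂ, f.Admissible ι₁ ∧ ∃ (V : HermSpace3 K ι₁) (σ : K →+* ℂ),
        (Model.picardCMUniverse exists_isReal_hodgeModel_holds hodgePQ_independent_of_hodgeModel_holds
          BallQuotient.ballQuotientUniformised_holds cmAbelianVarietyRealised_holds).PeriodNV ι₁ V K f.psi σ) →
      ∀ {P B : AbelianVariety ℂ}, AbelianVariety.IsProductOf (fun B : AbelianVariety ℂ =>
        ∃ (E : Type) (_ : Field E) (_ : NumberField E) (_ : IsCMField E) (_ : E →+* (K : Type)) (Φ : CMType E)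
          (ι : 𝓞 E →+* End B) (θ : E →+* Module.End ℂ (complexBetti B.X 1)),
          IsCMTypeRealisation Φ B ι θ) P →
      AVDominatedBy B P → HodgeConjectureFor B.dim B.X) := by
  have hA : Even (Fintype.card (ZMod 10)) := by rw [ZMod.card]; decide
  have h4 : 4 ≤ Fintype.card (ZMod 10) := by rw [ZMod.card]; decide
  obtain ⟨𝒮, hcard, h⟩ := exists_faceSet_evenSliceSquares_aut K hA h4 σ₀ ε hε hcσ hεc
  refine ⟨𝒮, ?_, h⟩
  rw [← Nat.card_eq_fintype_card, card_orbitsA_zmod_ten] at hcard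
  omega

/-- **`ℤ/2 × ℤ/12` with `c ∉ 2G` (`ℚ(ζ₃₅)`, `ℚ(ζ₃₉)`, `ℚ(ζ₄₅)`, `ℚ(ζ₅₂)`): at most `178` faces (lit-andre-3's degree-24 row)** whose periods on the universe of record imply the Hodge conjecture for every complex abelian variety dominated by a
finite product of abelian varieties realising CM types of CM fields embeddable in `K` (`card_orbitsA_zmod_twelve`).  (FRAMING: existence of the face
set + a conditional; `HC_CM` is not proved, no period is produced.)
[cite: Shimura1998, §6.2 Theorem 3 and §6.1 Corollary of Theorem 2 (pp. 41–43)] [cite: Pohlmann1968, Thm. 1]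
[cite: Milne1999LefschetzClasses, Thm. 3.2 and Cor. 4.5] [cite: MumfordAV1970, §19 Thm. 1 and p. 169] -/
theorem exists_faceSet_evenSlice_zmod_twelve (K : CMField) [hGal : IsGalois ℚ K] (σ₀ : (K : Type) →+* ℂ)
    (ε : ((K : Type) ≃ₐ[ℚ] (K : Type)) ≃ ZMod 2 × (ZMod 12))
    (hε : ∀ x y : ((K : Type) ≃ₐ[ℚ] (K : Type)), ε (x * y) = ε x + ε y)
    {c : ((K : Type) ≃ₐ[ℚ] (K : Type))} (hcσ : σ₀.comp (c : (K : Type) →+* (K : Type)) = conjugate σ₀) (hεc : ε c = (1, 0)) :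
    ∃ 𝒮 : Finset (Face K), 𝒮.card ≤ 178 ∧
      ((∀ f ∈ 𝒮, ∃ ι₁ : K →+* ℂ, f.Admissible ι₁ ∧ ∃ (V : HermSpace3 K ι₁) (σ : K →+* ℂ),
        (Model.picardCMUniverse exists_isReal_hodgeModel_holds hodgePQ_independent_of_hodgeModel_holds
          BallQuotient.ballQuotientUniformised_holds cmAbelianVarietyRealised_holds).PeriodNV ι₁ V K f.psi σ) →
      ∀ {P B : AbelianVariety ℂ}, AbelianVariety.IsProductOf (fun B : AbelianVariety ℂ =>
        ∃ (E : Type) (_ : Field E) (_ : NumberField E) (_ : IsCMField E) (_ : E →+* (K : Type)) (Φ : CMType E)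
          (ι : 𝓞 E →+* End B) (θ : E →+* Module.End ℂ (complexBetti B.X 1)),
          IsCMTypeRealisation Φ B ι θ) P →
      AVDominatedBy B P → HodgeConjectureFor B.dim B.X) := by
  have hA : Even (Fintype.card (ZMod 12)) := by rw [ZMod.card]; decide
  have h4 : 4 ≤ Fintype.card (ZMod 12) := by rw [ZMod.card]; decide
  obtain ⟨𝒮, hcard, h⟩ := exists_faceSet_evenSliceSquares_aut K hA h4 σ₀ ε hε hcσ hεc
  refine ⟨𝒮, ?_, h⟩
  rw [← Nat.card_eq_fintype_card, card_orbitsA_zmod_twelve] at hcard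
  omega

end Counts

end Summit.HodgeConjecture.CorCM

end
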